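import Literature.Geometry.Riemannian.HeatPropagation
import HarnessLib

/-!
# The heat propagation `(x, t) ↦ (P_{s→t} φ)(x)` is a smooth space-time heat solution
# (Bamler 2020a, §2: the heat operator of a Ricci flow)

Continuation of `HeatPropagation.lean`. For a family `h(r)` of Riemannian metrics on a closed
manifold `M`, `C^∞` on `M × ℝ`, and a smooth datum `φ`, the heat propagation `heatValue h s t x φ`
is defined slice by slice (at each `t > s` by a choice of a smooth solution on `M × [s, t]`). By
uniqueness of smooth solutions (`heatValue_eq`, Topping 2006, Thm. 3.1.1) all these choices agree
with ONE smooth solution on every `M × [s, T]` (`exists_isHeatSolutionOn_heatValue`), so that: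

* `isHeatSolutionOn_heatValue` — `(t, x) ↦ P_{s→t}φ(x)` is itself a smooth solution of
  `∂ₜ w = Δ_{h(t)} w` on `M × [s, T]` for every `T > s` (Bamler 2020a, §2: `u(·, t) = P_{s→t} u(·, s)`
  solves the heat equation coupled to the flow);
* `contMDiffOn_heatValue_spaceTime` — it is `C^∞` on the half space-time `M × [s, ∞)`;
* `hasDerivAt_heatValue` — at every interior time `t > s` it has the two-sided time derivative
  `Δ_{h(t)} (P_{s→t} φ)(x)`.

Everything is proved; no named facts; no new definitions.

## References

* R. H. Bamler, *Entropy and heat kernel bounds on a Ricci flow background*, arXiv:2008.07093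
  (2020), §2. [Bamler2020Entropy]
* P. Topping, *Lectures on the Ricci flow*, CUP 2006, Thm. 3.1.1. [Topping2006]
* A. Friedman, *Partial differential equations of parabolic type*, Prentice-Hall 1964, Ch. 3,
  Thm. 7. [Friedman1964]
-/

noncomputable section

open Bundle Set Function Filter Manifold MeasureTheory Measure TopologicalSpace
open scoped Manifold ContDiff Topology ENNReal NNReal

namespace Literature.Geometry.Riemannian

open Lorentzian Lorentzian.PseudoRiemannianMetric

section SpaceTime

variable {m : ℕ} {H : Type*} [TopologicalSpace H]
  {I : ModelWithCorners ℝ (EuclideanSpace ℝ (Fin m)) H} [I.Boundaryless]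
  {M : Type*} [TopologicalSpace M] [ChartedSpace H M] [IsManifold I ∞ M]
  [T2Space M] [CompactSpace M] [SecondCountableTopology M] [MeasurableSpace M] [BorelSpace M]
  {h : ℝ → PseudoRiemannianMetric I ∞ (EuclideanSpace ℝ (Fin m)) (TangentSpace I : M → Type _)}
  (hh : IsContMDiffFamilyOn ∞ h univ) (hR : ∀ r, (h r).IsRiemannian)

include hh hR in
/-- **The heat propagation is a smooth space-time heat solution**: for smooth `φ` and `s < T`,
`(t, x) ↦ (P_{s→t} φ)(x)` is a smooth solution of `∂ₜ w = Δ_{h(t)} w` on `M × [s, T]` with datum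
`φ` at time `s` (all the slice-wise choices in `heatValue` agree with one smooth solution on
`[s, T]` by uniqueness; Bamler 2020a, §2, `u(·, t) = ∫ K(·, t; y, s) u(y, s) dg_s(y)` solves the
heat equation coupled to the flow). [cite: Bamler2020Entropy, §2] -/
theorem isHeatSolutionOn_heatValue {s T : ℝ} (hsT : s < T) {φ : M → ℝ}
    (hφ : ContMDiff I 𝓘(ℝ, ℝ) ∞ φ) :
    IsHeatSolutionOn h (fun t x ↦ heatValue h s t x φ) s T := by
  obtain ⟨w, hw, -, hv⟩ := exists_isHeatSolutionOn_heatValue hh hR hsT hφ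
  refine ⟨hw.1.congr fun p hp ↦ hv p.2 hp.2 p.1, fun r hr x ↦ ?_⟩
  have e : (fun y ↦ heatValue h s r y φ) = w r := funext fun y ↦ hv r hr y
  show HasDerivWithinAt (fun r' ↦ heatValue h s r' x φ)
    ((h r).laplaceBeltrami (fun y ↦ heatValue h s r y φ) x) (Icc s T) r
  rw [e]
  exact (hw.2 r hr x).congr (fun r' hr' ↦ hv r' hr' x) (hv r hr x)

include hh hR in
/-- **The heat propagation is `C^∞` on the half space-time `M × [s, ∞)`**: for smooth `φ`,
`(x, t) ↦ (P_{s→t} φ)(x)` is `C^∞` on `M × [s, ∞)` (on each `M × [s, t₀ + 1]`, a neighbourhood of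
`(x, t₀)` within `M × [s, ∞)`, it is a smooth heat solution). [cite: Bamler2020Entropy, §2] -/
theorem contMDiffOn_heatValue_spaceTime (s : ℝ) {φ : M → ℝ} (hφ : ContMDiff I 𝓘(ℝ, ℝ) ∞ φ) :
    ContMDiffOn (I.prod 𝓘(ℝ, ℝ)) 𝓘(ℝ, ℝ) ∞ (fun p : M × ℝ ↦ heatValue h s p.2 p.1 φ)
      (univ ×ˢ Ici s) := by
  rintro ⟨x, t⟩ ⟨-, ht⟩
  have ht' : s ≤ t := ht
  have hsT : s < t + 1 := ht'.trans_lt (lt_add_one t)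
  have key := (isHeatSolutionOn_heatValue hh hR hsT hφ).1 (x, t)
    ⟨mem_univ _, ht', (lt_add_one t).le⟩
  refine key.mono_of_mem_nhdsWithin ?_
  rw [nhdsWithin_prod_eq]
  refine prod_mem_prod self_mem_nhdsWithin ?_
  rw [← Ici_inter_Iic]
  exact inter_mem_nhdsWithin (Ici s) (Iic_mem_nhds (lt_add_one t))

include hh hR in
/-- **The heat equation for the heat propagation at interior times**: for smooth `φ`, `s < t` and
`x ∈ M`, `t' ↦ (P_{s→t'} φ)(x)` has the (two-sided) derivative `Δ_{h(t)} (P_{s→t} φ)(x)` at `t`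
(`∂ₜ u = Δ_{g_t} u`, Bamler 2020a, §2). [cite: Bamler2020Entropy, §2] -/
theorem hasDerivAt_heatValue {s t : ℝ} (hst : s < t) {φ : M → ℝ} (hφ : ContMDiff I 𝓘(ℝ, ℝ) ∞ φ)
    (x : M) : HasDerivAt (fun t' ↦ heatValue h s t' x φ)
      ((h t).laplaceBeltrami (fun y ↦ heatValue h s t y φ) x) t := by
  have hsT : s < t + 1 := hst.trans (lt_add_one t)
  have key := (isHeatSolutionOn_heatValue hh hR hsT hφ).2 t ⟨hst.le, (lt_add_one t).le⟩ x
  exact key.hasDerivAt (Icc_mem_nhds hst (lt_add_one t))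

end SpaceTime

end Literature.Geometry.Riemannian

end
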